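import Literature.MathematicalPhysics.QuantumFieldTheory.Balaban1983to89.B15Prop1Carrier
import Literature.MathematicalPhysics.QuantumFieldTheory.Balaban1983to89.B15Prop1FromModel

/-!
# `Balaban1983to89.B15Prop1CarrierOnFromModel` — T. Bałaban, *Large field renormalization. I. The basic step of the 𝐑 operation*,
Commun. Math. Phys. **122** (1989) 175–202 [Balaban1989LargeFieldI] («[IV]»), **Proposition 1** p. 194, proof
[Balaban1989LargeFieldII] («[LF-II]») pp. 358–359: **`B15.Prop1Printed` AT THE CARRIER OF RECORD `B15Prop1Carrier.lfVarOn`**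
(print's orbits of the gauge transformations defined on `Λ^{(k)}`, criticality through the exponential chart, minimality over
the variables ∩ the domain of (1.77), the deviation `sup_{p′∈Λ}|V_Λ(∂p′) − 1|` — the typist's reading of record, p456691) FROM
the p. 359 real-Hilbert model (r13 ∕ r12 ∕ n12-b) and the LOCATED OBJECT DICTIONARY between the two: the chart
`B′ ↦ V′V_k = exp(iB′)·Ṽ_k(V_k)` of p. 359 and its four printed properties.

statement-level skeleton of published theorems with citation tags; proofs where landed; nothing here is a claim about
the Yang–Mills mass gap

Cell pub-ymgap, HUMAN RULING D-0062 (Track A full width), seat `pub-ymgap-dag-n12-c` (R134 acceleration seat (a), strategy s1 of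
DAG node N12 = [B15], «INHABIT `B15.Prop1Printed`»; fourth product).  This is the DISCHARGE SHAPE of N12's `p1` display at the
carrier NODE 00 is to pin (`ResidW.LF := fun P => lfVarOn ch (I P)`): every hypothesis below is either a letter of the p. 359
model already displayed in `B15Prop1FromModel` ∕ `B15Prop1ModelCarrier` or one of the four object-level chart facts (c1)–(c4) of
the printed proof, stated over print's objects (`orbit`, `extSet`, `dom`, `IsCriticalPt`, `plaqHol`).  PDFs held:
`paper:balaban1989-cmp122-large-field-i` (journal page = PDF page + 174; p. 194 = PDF 20), `paper:balaban1989-cmp122-large-field-ii`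
(journal page = PDF page + 354; p. 359 = PDF 5; text layers re-read by this seat 2026-08-26).

THE PRINT ([LF-II] p. 359, verbatim): *«We fix such an extension, and we consider the variational problem for the function
V′↾_Λ → A(U_{k,Z}(V′V_k)), where V′ satisfies mild regularity conditions. Fixing the gauge G₀ for V′ we get a small
configuration, and we can write V′ = exp iB′. We expand the function with respect to B′ … Now the condition for a critical
configuration is the equation (1.12) … Using Proposition 4 [15] and the fixed point theorem for contractive mappings, we can
easily prove that the above equation has exactly one solution … This proves the existence and the uniqueness statements of
Proposition 1 [IV], and the bound (1.78) [IV].»*  [IV] p. 194: *«(1.77) It is defined on configurations V_k satisfying mild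
regularity conditions, e.g., |∂V_k − 1| < a₁ on Z. The function is invariant with respect to the group of all gauge
transformations defined on Λ, hence it is natural to consider it on orbits of this group.»*

THE DICTIONARY (the located object-level content of those sentences, per instance `i`, datum `V_k` and gauge-fixed `B′` of the
chart ball `‖B′‖ ≤ r i`, with `φ i V_k B′ = exp(iB′)·Ṽ_k(V_k)` the chart and `S = Λ^{(k)}`):
(c1) *«V′ satisfies mild regularity conditions»* — for `ε`-regular data below a threshold `eD i`, the Λ-orbit of a chart point
     lies in the variables at `V_k` ∩ the domain of (1.77): `orbit S (φ B′) ⊆ extSet V_k ∩ dom`;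
(c2) *«Fixing the gauge G₀ for V′ we get a small configuration, and we can write V′ = exp iB′»* — every configuration of
     `extSet V_k ∩ dom` lies on the orbit of some chart point (gauge fixing + smallness);
(c3) *«the condition for a critical configuration is the equation (1.12)»* — at a chart point, `IsCriticalPt` ⇔ (1.12) for `B′`
     (the expansion pieces `H_{1,k}`, `Δ₁`, `(δ/δA)V`, `J_{k,Z}` of the function `B′ ↦ A(U_{k,Z}(φ B′))`, whose first variation
     (m5) is the left side of (1.12)); and criticality ∕ the value of the function pass along Λ-orbits (*«invariant with
     respect to the group»*; the carrier's `IsCriticalPt.gaugeAct_of_adCov`, `std_f_gaugeAct`);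
(c4) (1.78) on the chart — `|φB′(∂p′) − 1| ≤ a‖B′‖ + b·M²ε` for `p′` meeting `Λ^{(k)}` (chart Lipschitz bound + the p. 193
     extension *«|∂V_k − 1| < O(1)M²ε»*).

WHAT THIS FILE PROVES (theorems only; Mathlib + `B15Prop1Carrier` + `B15Prop1FromModel`; no `sorry`, no definition, no
`… : Prop` fact; axioms standard).  **`prop1Printed_lfVarOn_of_model`** — `B15.Prop1Printed (lfVarOn ch I)` from: the p. 359
model letters exactly as in n12-b's `prop1Printed_of_model` ((m1) (1.9) positivity `γ/M⁵`, (m2) `P₀` idempotent symmetric, `H*`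
adjoint, `‖H‖ ≤ h₁`, `‖H*‖ ≤ hst`, (m3) Prop. 4 [15] Lipschitz data + contraction smallness, (m4) `‖J‖ ≤ cJ·ε` on regular data,
(m5) the first variation of `B′ ↦ f (φ B′)` is (1.12), (x) the analytic-extension clause below `eA i`), and the dictionary
(c1)–(c4).  Proof = the p. 359 argument BY NAME: existence and the bound from r13's `B16Prop1IVAssembly.prop1IV_model_of_pos`,
uniqueness on the chart from n12-b's `B15Prop1FromModel.critical_unique_of_chart`, the minimum from r12's
`B15Prop1Minimum.le_of_critical`, the orbit bookkeeping from the carrier (`orbit_subset_extSet`-type facts are (c1) here,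
`OrbitSp.orbitOf_eq_of_mem`, `orbitOf_eq_orbitOf_iff`, `orbitDev_orbit_lt`).  Constants: `B₅ := 2·a·hst·cJ/γ + b + 1`,
`e0 i := min (min (eA i) (eD i)) (r i/(2(M i)⁵hst·cJ/γ + 1))`.

HONEST SCOPE.  (i) NOTHING of (c1)–(c4), (m1)–(m5), (x) is discharged here: the chart `φ`, the spaces `E i`, `F i` and the
operators are data, the dictionary is displayed — discharging it at NODE 00's objects (the tree-gauge chart on `Λ`-orbits:
`B15TreeGauge196` ∕ `B6BondElimination`; the expansion pieces of record; (1.9) at the box chart: `B15Prop1BoxChartCarrier.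
ineq19_bspace`; (1.80)-type chart deviation: `B15Ineq180Lattice`) is the located remainder of N12's `p1`.  (ii) The carrier is
`lfVarOn` (criticality inside `dom`); for the unrestricted `lfVar` the statement is refutable (`B15Prop1CarrierDomain`).  (iii)
`M`-exponent as printed (G-B16-02 bookkeeping in `B15Prop1FromModel.prop1Printed_of_model_ell2`).  Count-neutral; NOT a
discharge of N12 (that needs the pin and (c1)–(c4) at objects); NOT summit progress.

v1.1 (same seat lineage `pub-ymgap-dag-n12-c`, generation g2, same day; APPEND-ONLY — the v1 declarations are byte-identical;
this docstring extended).  LOCATED TYPING-STRENGTH POINT IN v1 AND ITS REPAIR.  v1's (c1) is asked for EVERY chart point of the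
ball `‖B‖ ≤ r i`, while the proof USES it only at the p. 359 solution `B`, whose norm is `≤ 2M⁵hst·cJ/γ · ε` (the fixed-point
bound).  Jointly with (c2) the strong form pins `extSet V_k ∩ dom` to be EXACTLY the union of the Λ-orbits of the chart points of
the closed `r`-ball; for the printed chart `B′ ↦ exp(iB′)·Ṽ_k` (continuous in `B′`), print's example domain `dom = domReg Z k a₁`
(*«|∂V_k − 1| < a₁ on Z»*, an open condition) and a connected compact matrix group, that union is compact while `extSet ∩ dom` is
relatively open in the connected `extSet ≅ G^{Λb}`, so the equality forces `extSet ∩ dom = extSet`, which fails as soon as `a₁` is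
below the diameter of `G` and a plaquette of `Z^{(k)}` meets `Λ^{(k)}` — i.e. at print's objects v1's (c1) ∧ (c2) are satisfiable
only degenerately (located by this seat while typing (c1)/(c2) at objects, `B15Prop1GaugeFixing` p463014; quantitatively, (c2)
needs `r ≥ C_ℓ·C(G₀)·(a₁ + bM²ε)` while the strong (c1) needs `4κ·r + bM²ε < a₁`, and `4κ·C_ℓ·C(G₀) > 1`).  Print needs (c1) ONLY at the solution (*«It satisfies the regularity condition |V_Λ(∂p′) − 1| < B₅M⁵ε»*): §2
`prop1Printed_lfVarOn_of_model_sol` is v1 with (c1) WEAKENED TO THE SOLUTION SCALE `‖B‖ ≤ 2M⁵hst·cJ/γ · ε` — same proof, the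
one use of (c1) fed the fixed-point bound instead of the ball radius.  This is the discharge shape of record from now on; v1 stays
(nothing imports it but the bus named it).  Count-neutral.
-/

noncomputable section

open Set
open scoped RealInnerProductSpace

namespace Literature.MathematicalPhysics.QuantumFieldTheory.Balaban1983to89.B15Prop1CarrierOnFromModel

open Literature.MathematicalPhysics.QuantumFieldTheory.Balaban1983to89
open B15DeterminingSets GaugeField B16Sect1Backgrounds B15Prop1Carrier B8Eq17ClassAkV1

variable {P : Params}

/-- Threshold bookkeeping (*«for ε > 0 sufficiently small»*): `ε ≤ r/(K + 1)`, `K ≥ 0`, `r > 0` ⇒ `K·ε ≤ r` (private plumbing,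
as in `B15Prop1FromModel`). [folklore] -/
private theorem threshold_arith {K r ε : ℝ} (hK : 0 ≤ K) (hr : 0 < r) (hε : ε ≤ r / (K + 1)) : K * ε ≤ r := by
  have hK1 : 0 < K + 1 := by linarith
  have hfrac : K / (K + 1) ≤ 1 := by rw [div_le_one hK1]; linarith
  calc K * ε ≤ K * (r / (K + 1)) := mul_le_mul_of_nonneg_left hε hK
    _ = r * (K / (K + 1)) := by ring
    _ ≤ r * 1 := mul_le_mul_of_nonneg_left hfrac hr.le
    _ = r := mul_one r

/-- (1.78) bookkeeping: `a·(K·ε) + b·M²·ε < (2·a·hst·cJ/γ + b + 1)·M⁵·ε` for `K = 2M⁵hst·cJ/γ`, `M ≥ 1`, `ε > 0`, `b ≥ 0`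
(private plumbing, as in `B15Prop1FromModel`). [folklore] -/
private theorem dev_arith {a b hst cJ γ M ε : ℝ} (hb : 0 ≤ b) (hM : 1 ≤ M) (hε : 0 < ε) :
    a * (2 * M ^ 5 * hst * cJ / γ * ε) + b * M ^ 2 * ε < (2 * a * hst * cJ / γ + b + 1) * M ^ 5 * ε := by
  have hM2 : M ^ 2 ≤ M ^ 5 := pow_le_pow_right₀ hM (by norm_num)
  have hM5 : 0 < M ^ 5 := by positivity
  have h1 : a * (2 * M ^ 5 * hst * cJ / γ * ε) = 2 * a * hst * cJ / γ * M ^ 5 * ε := by ring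
  have h2 : b * M ^ 2 * ε ≤ b * M ^ 5 * ε :=
    mul_le_mul_of_nonneg_right (mul_le_mul_of_nonneg_left hM2 hb) hε.le
  have h3 : 0 < M ^ 5 * ε := mul_pos hM5 hε
  have h4 : (2 * a * hst * cJ / γ + b + 1) * M ^ 5 * ε =
      2 * a * hst * cJ / γ * M ^ 5 * ε + b * M ^ 5 * ε + M ^ 5 * ε := by ring
  rw [h1, h4]
  linarith

variable {G : Type} [GaugeGroup G] {𝔤 : Type*} [AddCommGroup 𝔤] [Module ℝ 𝔤]

/-- **Proposition 1 [IV] — `B15.Prop1Printed` — AT THE CARRIER OF RECORD `lfVarOn ch I`, from the p. 359 model and the object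
dictionary.**  Data per instance `i` and datum `V_k`: finite-dimensional real inner-product spaces `E i` (gauge-fixed `B′`) and
`F i` (fine-lattice fields), the gauge projection `P₀ i` (idempotent, symmetric), `H i V_k = H_{1,k}`, `Hst i V_k = H*_{1,k}`
(adjoint; `‖H‖ ≤ h₁`, `‖H*‖ ≤ hst`), `Δ₁ i V_k`, `dV i V_k = (δ/δA)V` (`dV 0 = 0`, `ℓ i`-Lipschitz on the ball of radius
`ρ i ≥ h₁·r i`; *«Proposition 4 [15]»*), the current `J i V_k` with `‖J‖ ≤ cJ·ε` on `ε`-regular data, the positivity (1.9)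
`γ/(M i)⁵`, the contraction smallness, and THE CHART `φ i V_k : E i → GaugeField` (*«V′V_k»*, `V′ = exp iB′` in the gauge `G₀`,
relative to the fixed extension of `V_k`) with: (m5) the function `B′ ↦ f (φ B′)` has first variation (1.12); (c1) below the
domain threshold `eD i`, on regular data, the Λ-orbit of each chart point of the ball lies in `extSet V_k ∩ dom`; (c2) every
configuration of `extSet V_k ∩ dom` lies on the Λ-orbit of a chart point of the ball; (c3) at chart points of the ball
`IsCriticalPt ⇔ (1.12)`, criticality passes along Λ-orbits, `f` is Λ-gauge invariant; (c4) `|φB′(∂p′) − 1| ≤ a‖B′‖ + b(M i)²ε` for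
`p′` meeting `Λ^{(k)}` on regular data; (x) the analytic-extension clause below `eA i`; `1 ≤ M i`, `0 < r i`.  CONCLUSION:
`B15.Prop1Printed (lfVarOn ch I)` — exactly one critical orbit inside the domain, it is the orbit of the p. 359 solution, it
contains a minimum over the variables ∩ domain, its deviation is `< B₅(M i)⁵ε` with `B₅ = 2·a·hst·cJ/γ + b + 1`, thresholds
`e0 i = min (min (eA i) (eD i)) (r i/(2(M i)⁵hst·cJ/γ + 1))`.  BY NAME: `B16Prop1IVAssembly.prop1IV_model_of_pos`,
`B15Prop1FromModel.critical_unique_of_chart`, `B15Prop1Minimum.le_of_critical`, the carrier's orbit lemmas.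
[cite: Balaban1989LargeFieldI, Prop. 1 (1.77)–(1.78) p.194; Balaban1989LargeFieldII, pp.358–359 (proof of Proposition 1 [IV]),
(1.9), (1.12)–(1.13); Balaban1985Variational, Prop. 4 p.293] -/
theorem prop1Printed_lfVarOn_of_model (ch : ExpChart G 𝔤) {ι : Type} (I : ι → InstOn P G)
    {E F : ι → Type*}
    [∀ i, NormedAddCommGroup (E i)] [∀ i, InnerProductSpace ℝ (E i)] [∀ i, FiniteDimensional ℝ (E i)]
    [∀ i, NormedAddCommGroup (F i)] [∀ i, InnerProductSpace ℝ (F i)]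
    (P₀ : ∀ i, E i →ₗ[ℝ] E i) (hP2 : ∀ i x, P₀ i (P₀ i x) = P₀ i x) (hPsa : ∀ i (x y : E i), ⟪P₀ i x, y⟫ = ⟪x, P₀ i y⟫)
    (H : ∀ i, GaugeField P (I i).k G → (E i →ₗ[ℝ] F i)) (Hst : ∀ i, GaugeField P (I i).k G → (F i →ₗ[ℝ] E i))
    (hadj : ∀ i Vk (x : E i) (y : F i), ⟪H i Vk x, y⟫ = ⟪x, Hst i Vk y⟫)
    (Δ₁ : ∀ i, GaugeField P (I i).k G → (F i →ₗ[ℝ] F i)) (dV : ∀ i, GaugeField P (I i).k G → F i → F i)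
    (J : ∀ i, GaugeField P (I i).k G → F i)
    (φ : ∀ i, GaugeField P (I i).k G → E i → GaugeField P (I i).k G)
    {γ h₁ hst cJ a b : ℝ} (hγ : 0 < γ) (hh₁ : 0 ≤ h₁) (hhst : 0 ≤ hst) (hcJ : 0 ≤ cJ) (ha : 0 ≤ a) (hb : 0 ≤ b)
    {ℓ ρ r eA eD : ι → ℝ} (hℓ : ∀ i, 0 ≤ ℓ i) (hr : ∀ i, 0 < r i) (heA : ∀ i, 0 < eA i) (heD : ∀ i, 0 < eD i)
    (hM : ∀ i, 1 ≤ (I i).M)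
    (hpos : ∀ i Vk x, P₀ i x = x → γ / (I i).M ^ 5 * ‖x‖ ^ 2 ≤ ⟪H i Vk x, Δ₁ i Vk (H i Vk x)⟫)
    (hH : ∀ i Vk x, ‖H i Vk x‖ ≤ h₁ * ‖x‖) (hHst : ∀ i Vk z, ‖Hst i Vk z‖ ≤ hst * ‖z‖)
    (hdV0 : ∀ i Vk, dV i Vk 0 = 0)
    (hdV : ∀ i Vk (u v : F i), ‖u‖ ≤ ρ i → ‖v‖ ≤ ρ i → ‖dV i Vk u - dV i Vk v‖ ≤ ℓ i * ‖u - v‖)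
    (hρ : ∀ i, h₁ * r i ≤ ρ i) (hsmall : ∀ i, (I i).M ^ 5 / γ * hst * ℓ i * h₁ ≤ 1 / 2)
    (hA : ∀ i Vk (X δ : E i), HasDerivAt (fun s : ℝ => (I i).f (φ i Vk (X + s • δ)))
      (⟪δ, Hst i Vk (J i Vk)⟫ + ⟪δ, Hst i Vk (Δ₁ i Vk (H i Vk X))⟫ + ⟪δ, Hst i Vk (dV i Vk (H i Vk X))⟫) 0)
    (hJ : ∀ i ε Vk, 0 < ε → (lfVarOn ch I).Regular i ε Vk → ‖J i Vk‖ ≤ cJ * ε)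
    (hc1 : ∀ i ε Vk (B : E i), 0 < ε → ε ≤ eD i → (lfVarOn ch I).Regular i ε Vk → P₀ i B = B → ‖B‖ ≤ r i →
      orbit (pts (I i).k (I i).Λ) (φ i Vk B) ⊆ extSet (bondsOf (pts (I i).k (I i).Λ)) Vk ∩ (I i).dom)
    (hc2 : ∀ i ε Vk (V : GaugeField P (I i).k G), 0 < ε → ε ≤ eD i → (lfVarOn ch I).Regular i ε Vk →
      V ∈ extSet (bondsOf (pts (I i).k (I i).Λ)) Vk ∩ (I i).dom →
        ∃ B : E i, P₀ i B = B ∧ ‖B‖ ≤ r i ∧ V ∈ orbit (pts (I i).k (I i).Λ) (φ i Vk B))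
    (hc3 : ∀ i Vk (B : E i), P₀ i B = B → ‖B‖ ≤ r i →
      (IsCriticalPt ch (bondsOf (pts (I i).k (I i).Λ)) (I i).f (φ i Vk B) ↔
        ∀ δB : E i, P₀ i δB = δB →
          ⟪δB, Hst i Vk (J i Vk)⟫ + ⟪δB, Hst i Vk (Δ₁ i Vk (H i Vk B))⟫ + ⟪δB, Hst i Vk (dV i Vk (H i Vk B))⟫ = 0))
    (hc3' : ∀ i (u : GaugeTransf P (I i).k G) (V : GaugeField P (I i).k G), IsGaugeOn (pts (I i).k (I i).Λ) u →
      IsCriticalPt ch (bondsOf (pts (I i).k (I i).Λ)) (I i).f V →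
        IsCriticalPt ch (bondsOf (pts (I i).k (I i).Λ)) (I i).f (gaugeAct u V))
    (hc3'' : ∀ i (u : GaugeTransf P (I i).k G) (V : GaugeField P (I i).k G), IsGaugeOn (pts (I i).k (I i).Λ) u →
      (I i).f (gaugeAct u V) = (I i).f V)
    (hc4 : ∀ i ε Vk (B : E i), 0 < ε → (lfVarOn ch I).Regular i ε Vk → P₀ i B = B → ‖B‖ ≤ r i →
      ∀ p ∈ plaqsOf (pts (I i).k (I i).Λ), dist1 (plaqHol (φ i Vk B) p) ≤ a * ‖B‖ + b * (I i).M ^ 2 * ε)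
    (hAn : ∀ i ε Vk, 0 < ε → ε ≤ eA i → (lfVarOn ch I).Regular i ε Vk → (I i).An ε Vk) :
    B15.Prop1Printed (lfVarOn ch I) := by
  rw [prop1Printed_lfVarOn_iff]
  refine ⟨2 * a * hst * cJ / γ + b + 1, by positivity, fun i => ?_⟩
  -- the per-instance letters: positivity constant `c = γ/M⁵` of (1.9) and the radius factor `K = 2M⁵hst·cJ/γ`
  have hM0 : 0 < (I i).M := lt_of_lt_of_le one_pos (hM i)
  have hc : 0 < γ / (I i).M ^ 5 := div_pos hγ (pow_pos hM0 5)
  have hcinv : (γ / (I i).M ^ 5)⁻¹ = (I i).M ^ 5 / γ := inv_div _ _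
  have hK : 0 ≤ 2 * (I i).M ^ 5 * hst * cJ / γ := by positivity
  refine ⟨min (min (eA i) (eD i)) (r i / (2 * (I i).M ^ 5 * hst * cJ / γ + 1)),
    lt_min (lt_min (heA i) (heD i)) (div_pos (hr i) (by linarith)), fun ε hε hεle Vk hreg => ?_⟩
  have hεA : ε ≤ eA i := hεle.trans ((min_le_left _ _).trans (min_le_left _ _))
  have hεD : ε ≤ eD i := hεle.trans ((min_le_left _ _).trans (min_le_right _ _))
  have hεK : 2 * (I i).M ^ 5 * hst * cJ / γ * ε ≤ r i :=
    threshold_arith hK (hr i) (hεle.trans (min_le_right _ _))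
  -- the model hypotheses at `(i, V_k)`
  have hsmall' : (γ / (I i).M ^ 5)⁻¹ * hst * ℓ i * h₁ ≤ 1 / 2 := by rw [hcinv]; exact hsmall i
  have hJ' : ‖J i Vk‖ ≤ cJ * ε := hJ i ε Vk hε hreg
  have hball : 2 * ((γ / (I i).M ^ 5)⁻¹ * hst * ‖J i Vk‖) ≤ 2 * (I i).M ^ 5 * hst * cJ / γ * ε := by
    rw [hcinv]
    have := mul_le_mul_of_nonneg_left hJ' (mul_nonneg (div_nonneg (pow_nonneg hM0.le 5) hγ.le) hhst)
    calc 2 * ((I i).M ^ 5 / γ * hst * ‖J i Vk‖) ≤ 2 * ((I i).M ^ 5 / γ * hst * (cJ * ε)) := by linarith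
      _ = 2 * (I i).M ^ 5 * hst * cJ / γ * ε := by ring
  have hballr : 2 * ((γ / (I i).M ^ 5)⁻¹ * hst * ‖J i Vk‖) ≤ r i := hball.trans hεK
  have hρ' : h₁ * (2 * ((γ / (I i).M ^ 5)⁻¹ * hst * ‖J i Vk‖)) ≤ ρ i :=
    (mul_le_mul_of_nonneg_left hballr hh₁).trans (hρ i)
  -- existence + «twice a bound of the right-hand side» (r13, inverse from (1.9))
  obtain ⟨Kinv, -, hJb, B, ⟨hBg, hBn, hBcrit⟩, -⟩ :=
    B16Prop1IVAssembly.prop1IV_model_of_pos (hP2 i) (hPsa i) (H i Vk) (Hst i Vk) (hadj i Vk) (Δ₁ i Vk)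
      (dV i Vk) (J i Vk) hc (hpos i Vk) (hdV0 i Vk) hh₁ hhst (hℓ i) (hH i Vk) (hHst i Vk) (hdV i Vk) hρ' hsmall'
  have hBK : ‖B‖ ≤ 2 * (I i).M ^ 5 * hst * cJ / γ * ε := hBn.trans (hJb.trans hball)
  have hBr : ‖B‖ ≤ r i := hBK.trans hεK
  -- names for print's objects at this instance
  set S := pts (I i).k (I i).Λ with hS
  set Λb := bondsOf S with hΛb
  have hsub : orbit S (φ i Vk B) ⊆ extSet Λb Vk ∩ (I i).dom := hc1 i ε Vk B hε hεD hreg hBg hBr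
  have hcritφ : IsCriticalPt ch Λb (I i).f (φ i Vk B) := (hc3 i Vk B hBg hBr).2 hBcrit
  refine ⟨orbitOf S (φ i Vk B), ⟨hsub, φ i Vk B, mem_orbitOf_self _ _, hcritφ⟩, ?_, ?_, ?_, hAn i ε Vk hε hεA hreg⟩
  · -- exactly one critical orbit inside the domain
    rintro O' ⟨hO'sub, V, hV, hVcrit⟩
    obtain ⟨B', hB'g, hB'n, hVorb⟩ := hc2 i ε Vk V hε hεD hreg (hO'sub hV)
    obtain ⟨u, hu, hVu⟩ := hVorb
    have hφB' : φ i Vk B' = gaugeAct (invG u) V := by rw [hVu, gaugeAct_invG_gaugeAct]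
    have hcrit' : IsCriticalPt ch Λb (I i).f (φ i Vk B') := by
      rw [hφB']
      exact hc3' i (invG u) V hu.inv hVcrit
    have h112' := (hc3 i Vk B' hB'g hB'n).1 hcrit'
    have hEq : B' = B :=
      B15Prop1FromModel.critical_unique_of_chart (H i Vk) (Hst i Vk) (hadj i Vk) (Δ₁ i Vk) (dV i Vk) (J i Vk)
        (A := fun X => (I i).f (φ i Vk X)) (hA i Vk) hc (hpos i Vk) hh₁ hhst (hℓ i) (hH i Vk) (hHst i Vk) (hdV i Vk) (hρ i) hsmall' hBg hBr hBcrit hB'g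
        hB'n h112'
    calc O' = orbitOf S V := (OrbitSp.orbitOf_eq_of_mem hV).symm
      _ = orbitOf S (φ i Vk B') := orbitOf_eq_orbitOf_iff.2 ⟨u, hu, hVu⟩
      _ = orbitOf S (φ i Vk B) := by rw [hEq]
  · -- an element of the orbit is a minimum of the function over the variables ∩ the domain
    refine ⟨φ i Vk B, mem_orbitOf_self _ _, hsub (mem_orbit_self _ _), fun W hW => ?_⟩
    obtain ⟨B', hB'g, hB'n, u, hu, hWu⟩ := hc2 i ε Vk W hε hεD hreg hW
    rw [hWu, hc3'' i u _ hu]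
    exact B15Prop1Minimum.le_of_critical (H i Vk) (Hst i Vk) (hadj i Vk) (Δ₁ i Vk) (dV i Vk) (J i Vk)
      (A := fun X => (I i).f (φ i Vk X)) (hA i Vk) hc (hpos i Vk) hh₁ hhst (hℓ i) (hH i Vk) (hHst i Vk) (hdV i Vk) (hρ i) hsmall' hBg hBr hBcrit hB'g hB'n
  · -- (1.78) for the orbit
    have hB5 : 0 < (2 * a * hst * cJ / γ + b + 1) * (I i).M ^ 5 * ε := by positivity
    refine orbitDev_orbit_lt hB5 fun p hp => ?_
    calc dist1 (plaqHol (φ i Vk B) p) ≤ a * ‖B‖ + b * (I i).M ^ 2 * ε := hc4 i ε Vk B hε hreg hBg hBr p hp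
      _ ≤ a * (2 * (I i).M ^ 5 * hst * cJ / γ * ε) + b * (I i).M ^ 2 * ε := by
          have := mul_le_mul_of_nonneg_left hBK ha
          linarith
      _ < (2 * a * hst * cJ / γ + b + 1) * (I i).M ^ 5 * ε := dev_arith hb (hM i) hε

/-! ## §2 (v1.1, append-only) (c1) at the solution scale — the discharge shape of record -/

/-- **v1.1 §2 — Proposition 1 [IV] AT THE CARRIER OF RECORD, (c1) AT THE SOLUTION SCALE (the discharge shape of record).**  As
`prop1Printed_lfVarOn_of_model` (v1), EXCEPT that the dictionary item (c1) (*«V′ satisfies mild regularity conditions»* ∕ the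
orbit of the chart point lies in the variables ∩ the domain) is asked only for chart points with `‖B‖ ≤ 2M⁵hst·cJ/γ · ε` — the
fixed-point bound of the p. 359 solution (*«it can be bounded by 2γ₀⁻¹2d(100M)⁵B₃²4ε_k»*), which is the only place the proof
uses it; see the v1.1 header paragraph for why the v1 form (all of the `r`-ball) is too strong at print's example domain.
ORIGINAL v1 DOCSTRING (data and the other letters unchanged): **Proposition 1 [IV] — `B15.Prop1Printed` — AT THE CARRIER OF
RECORD `lfVarOn ch I`, from the p. 359 model and the object dictionary.**  Data per instance `i` and datum `V_k`: finite-dimensional real inner-product spaces `E i` (gauge-fixed `B′`) and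
`F i` (fine-lattice fields), the gauge projection `P₀ i` (idempotent, symmetric), `H i V_k = H_{1,k}`, `Hst i V_k = H*_{1,k}`
(adjoint; `‖H‖ ≤ h₁`, `‖H*‖ ≤ hst`), `Δ₁ i V_k`, `dV i V_k = (δ/δA)V` (`dV 0 = 0`, `ℓ i`-Lipschitz on the ball of radius
`ρ i ≥ h₁·r i`; *«Proposition 4 [15]»*), the current `J i V_k` with `‖J‖ ≤ cJ·ε` on `ε`-regular data, the positivity (1.9)
`γ/(M i)⁵`, the contraction smallness, and THE CHART `φ i V_k : E i → GaugeField` (*«V′V_k»*, `V′ = exp iB′` in the gauge `G₀`,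
relative to the fixed extension of `V_k`) with: (m5) the function `B′ ↦ f (φ B′)` has first variation (1.12); (c1) below the
domain threshold `eD i`, on regular data, the Λ-orbit of each chart point of the ball lies in `extSet V_k ∩ dom`; (c2) every
configuration of `extSet V_k ∩ dom` lies on the Λ-orbit of a chart point of the ball; (c3) at chart points of the ball
`IsCriticalPt ⇔ (1.12)`, criticality passes along Λ-orbits, `f` is Λ-gauge invariant; (c4) `|φB′(∂p′) − 1| ≤ a‖B′‖ + b(M i)²ε` for
`p′` meeting `Λ^{(k)}` on regular data; (x) the analytic-extension clause below `eA i`; `1 ≤ M i`, `0 < r i`.  CONCLUSION: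
`B15.Prop1Printed (lfVarOn ch I)` — exactly one critical orbit inside the domain, it is the orbit of the p. 359 solution, it
contains a minimum over the variables ∩ domain, its deviation is `< B₅(M i)⁵ε` with `B₅ = 2·a·hst·cJ/γ + b + 1`, thresholds
`e0 i = min (min (eA i) (eD i)) (r i/(2(M i)⁵hst·cJ/γ + 1))`.  BY NAME: `B16Prop1IVAssembly.prop1IV_model_of_pos`,
`B15Prop1FromModel.critical_unique_of_chart`, `B15Prop1Minimum.le_of_critical`, the carrier's orbit lemmas.
[cite: Balaban1989LargeFieldI, Prop. 1 (1.77)–(1.78) p.194; Balaban1989LargeFieldII, pp.358–359 (proof of Proposition 1 [IV]),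
(1.9), (1.12)–(1.13); Balaban1985Variational, Prop. 4 p.293] -/
theorem prop1Printed_lfVarOn_of_model_sol (ch : ExpChart G 𝔤) {ι : Type} (I : ι → InstOn P G)
    {E F : ι → Type*}
    [∀ i, NormedAddCommGroup (E i)] [∀ i, InnerProductSpace ℝ (E i)] [∀ i, FiniteDimensional ℝ (E i)]
    [∀ i, NormedAddCommGroup (F i)] [∀ i, InnerProductSpace ℝ (F i)]
    (P₀ : ∀ i, E i →ₗ[ℝ] E i) (hP2 : ∀ i x, P₀ i (P₀ i x) = P₀ i x) (hPsa : ∀ i (x y : E i), ⟪P₀ i x, y⟫ = ⟪x, P₀ i y⟫)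
    (H : ∀ i, GaugeField P (I i).k G → (E i →ₗ[ℝ] F i)) (Hst : ∀ i, GaugeField P (I i).k G → (F i →ₗ[ℝ] E i))
    (hadj : ∀ i Vk (x : E i) (y : F i), ⟪H i Vk x, y⟫ = ⟪x, Hst i Vk y⟫)
    (Δ₁ : ∀ i, GaugeField P (I i).k G → (F i →ₗ[ℝ] F i)) (dV : ∀ i, GaugeField P (I i).k G → F i → F i)
    (J : ∀ i, GaugeField P (I i).k G → F i)
    (φ : ∀ i, GaugeField P (I i).k G → E i → GaugeField P (I i).k G)
    {γ h₁ hst cJ a b : ℝ} (hγ : 0 < γ) (hh₁ : 0 ≤ h₁) (hhst : 0 ≤ hst) (hcJ : 0 ≤ cJ) (ha : 0 ≤ a) (hb : 0 ≤ b)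
    {ℓ ρ r eA eD : ι → ℝ} (hℓ : ∀ i, 0 ≤ ℓ i) (hr : ∀ i, 0 < r i) (heA : ∀ i, 0 < eA i) (heD : ∀ i, 0 < eD i)
    (hM : ∀ i, 1 ≤ (I i).M)
    (hpos : ∀ i Vk x, P₀ i x = x → γ / (I i).M ^ 5 * ‖x‖ ^ 2 ≤ ⟪H i Vk x, Δ₁ i Vk (H i Vk x)⟫)
    (hH : ∀ i Vk x, ‖H i Vk x‖ ≤ h₁ * ‖x‖) (hHst : ∀ i Vk z, ‖Hst i Vk z‖ ≤ hst * ‖z‖)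
    (hdV0 : ∀ i Vk, dV i Vk 0 = 0)
    (hdV : ∀ i Vk (u v : F i), ‖u‖ ≤ ρ i → ‖v‖ ≤ ρ i → ‖dV i Vk u - dV i Vk v‖ ≤ ℓ i * ‖u - v‖)
    (hρ : ∀ i, h₁ * r i ≤ ρ i) (hsmall : ∀ i, (I i).M ^ 5 / γ * hst * ℓ i * h₁ ≤ 1 / 2)
    (hA : ∀ i Vk (X δ : E i), HasDerivAt (fun s : ℝ => (I i).f (φ i Vk (X + s • δ)))
      (⟪δ, Hst i Vk (J i Vk)⟫ + ⟪δ, Hst i Vk (Δ₁ i Vk (H i Vk X))⟫ + ⟪δ, Hst i Vk (dV i Vk (H i Vk X))⟫) 0)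
    (hJ : ∀ i ε Vk, 0 < ε → (lfVarOn ch I).Regular i ε Vk → ‖J i Vk‖ ≤ cJ * ε)
    (hc1 : ∀ i ε Vk (B : E i), 0 < ε → ε ≤ eD i → (lfVarOn ch I).Regular i ε Vk → P₀ i B = B →
      ‖B‖ ≤ 2 * (I i).M ^ 5 * hst * cJ / γ * ε →
      orbit (pts (I i).k (I i).Λ) (φ i Vk B) ⊆ extSet (bondsOf (pts (I i).k (I i).Λ)) Vk ∩ (I i).dom)
    (hc2 : ∀ i ε Vk (V : GaugeField P (I i).k G), 0 < ε → ε ≤ eD i → (lfVarOn ch I).Regular i ε Vk →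
      V ∈ extSet (bondsOf (pts (I i).k (I i).Λ)) Vk ∩ (I i).dom →
        ∃ B : E i, P₀ i B = B ∧ ‖B‖ ≤ r i ∧ V ∈ orbit (pts (I i).k (I i).Λ) (φ i Vk B))
    (hc3 : ∀ i Vk (B : E i), P₀ i B = B → ‖B‖ ≤ r i →
      (IsCriticalPt ch (bondsOf (pts (I i).k (I i).Λ)) (I i).f (φ i Vk B) ↔
        ∀ δB : E i, P₀ i δB = δB →
          ⟪δB, Hst i Vk (J i Vk)⟫ + ⟪δB, Hst i Vk (Δ₁ i Vk (H i Vk B))⟫ + ⟪δB, Hst i Vk (dV i Vk (H i Vk B))⟫ = 0))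
    (hc3' : ∀ i (u : GaugeTransf P (I i).k G) (V : GaugeField P (I i).k G), IsGaugeOn (pts (I i).k (I i).Λ) u →
      IsCriticalPt ch (bondsOf (pts (I i).k (I i).Λ)) (I i).f V →
        IsCriticalPt ch (bondsOf (pts (I i).k (I i).Λ)) (I i).f (gaugeAct u V))
    (hc3'' : ∀ i (u : GaugeTransf P (I i).k G) (V : GaugeField P (I i).k G), IsGaugeOn (pts (I i).k (I i).Λ) u →
      (I i).f (gaugeAct u V) = (I i).f V)
    (hc4 : ∀ i ε Vk (B : E i), 0 < ε → (lfVarOn ch I).Regular i ε Vk → P₀ i B = B → ‖B‖ ≤ r i →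
      ∀ p ∈ plaqsOf (pts (I i).k (I i).Λ), dist1 (plaqHol (φ i Vk B) p) ≤ a * ‖B‖ + b * (I i).M ^ 2 * ε)
    (hAn : ∀ i ε Vk, 0 < ε → ε ≤ eA i → (lfVarOn ch I).Regular i ε Vk → (I i).An ε Vk) :
    B15.Prop1Printed (lfVarOn ch I) := by
  rw [prop1Printed_lfVarOn_iff]
  refine ⟨2 * a * hst * cJ / γ + b + 1, by positivity, fun i => ?_⟩
  -- the per-instance letters: positivity constant `c = γ/M⁵` of (1.9) and the radius factor `K = 2M⁵hst·cJ/γ`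
  have hM0 : 0 < (I i).M := lt_of_lt_of_le one_pos (hM i)
  have hc : 0 < γ / (I i).M ^ 5 := div_pos hγ (pow_pos hM0 5)
  have hcinv : (γ / (I i).M ^ 5)⁻¹ = (I i).M ^ 5 / γ := inv_div _ _
  have hK : 0 ≤ 2 * (I i).M ^ 5 * hst * cJ / γ := by positivity
  refine ⟨min (min (eA i) (eD i)) (r i / (2 * (I i).M ^ 5 * hst * cJ / γ + 1)),
    lt_min (lt_min (heA i) (heD i)) (div_pos (hr i) (by linarith)), fun ε hε hεle Vk hreg => ?_⟩
  have hεA : ε ≤ eA i := hεle.trans ((min_le_left _ _).trans (min_le_left _ _))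
  have hεD : ε ≤ eD i := hεle.trans ((min_le_left _ _).trans (min_le_right _ _))
  have hεK : 2 * (I i).M ^ 5 * hst * cJ / γ * ε ≤ r i :=
    threshold_arith hK (hr i) (hεle.trans (min_le_right _ _))
  -- the model hypotheses at `(i, V_k)`
  have hsmall' : (γ / (I i).M ^ 5)⁻¹ * hst * ℓ i * h₁ ≤ 1 / 2 := by rw [hcinv]; exact hsmall i
  have hJ' : ‖J i Vk‖ ≤ cJ * ε := hJ i ε Vk hε hreg
  have hball : 2 * ((γ / (I i).M ^ 5)⁻¹ * hst * ‖J i Vk‖) ≤ 2 * (I i).M ^ 5 * hst * cJ / γ * ε := by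
    rw [hcinv]
    have := mul_le_mul_of_nonneg_left hJ' (mul_nonneg (div_nonneg (pow_nonneg hM0.le 5) hγ.le) hhst)
    calc 2 * ((I i).M ^ 5 / γ * hst * ‖J i Vk‖) ≤ 2 * ((I i).M ^ 5 / γ * hst * (cJ * ε)) := by linarith
      _ = 2 * (I i).M ^ 5 * hst * cJ / γ * ε := by ring
  have hballr : 2 * ((γ / (I i).M ^ 5)⁻¹ * hst * ‖J i Vk‖) ≤ r i := hball.trans hεK
  have hρ' : h₁ * (2 * ((γ / (I i).M ^ 5)⁻¹ * hst * ‖J i Vk‖)) ≤ ρ i :=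
    (mul_le_mul_of_nonneg_left hballr hh₁).trans (hρ i)
  -- existence + «twice a bound of the right-hand side» (r13, inverse from (1.9))
  obtain ⟨Kinv, -, hJb, B, ⟨hBg, hBn, hBcrit⟩, -⟩ :=
    B16Prop1IVAssembly.prop1IV_model_of_pos (hP2 i) (hPsa i) (H i Vk) (Hst i Vk) (hadj i Vk) (Δ₁ i Vk)
      (dV i Vk) (J i Vk) hc (hpos i Vk) (hdV0 i Vk) hh₁ hhst (hℓ i) (hH i Vk) (hHst i Vk) (hdV i Vk) hρ' hsmall'
  have hBK : ‖B‖ ≤ 2 * (I i).M ^ 5 * hst * cJ / γ * ε := hBn.trans (hJb.trans hball)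
  have hBr : ‖B‖ ≤ r i := hBK.trans hεK
  -- names for print's objects at this instance
  set S := pts (I i).k (I i).Λ with hS
  set Λb := bondsOf S with hΛb
  have hsub : orbit S (φ i Vk B) ⊆ extSet Λb Vk ∩ (I i).dom := hc1 i ε Vk B hε hεD hreg hBg hBK
  have hcritφ : IsCriticalPt ch Λb (I i).f (φ i Vk B) := (hc3 i Vk B hBg hBr).2 hBcrit
  refine ⟨orbitOf S (φ i Vk B), ⟨hsub, φ i Vk B, mem_orbitOf_self _ _, hcritφ⟩, ?_, ?_, ?_, hAn i ε Vk hε hεA hreg⟩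
  · -- exactly one critical orbit inside the domain
    rintro O' ⟨hO'sub, V, hV, hVcrit⟩
    obtain ⟨B', hB'g, hB'n, hVorb⟩ := hc2 i ε Vk V hε hεD hreg (hO'sub hV)
    obtain ⟨u, hu, hVu⟩ := hVorb
    have hφB' : φ i Vk B' = gaugeAct (invG u) V := by rw [hVu, gaugeAct_invG_gaugeAct]
    have hcrit' : IsCriticalPt ch Λb (I i).f (φ i Vk B') := by
      rw [hφB']
      exact hc3' i (invG u) V hu.inv hVcrit
    have h112' := (hc3 i Vk B' hB'g hB'n).1 hcrit'
    have hEq : B' = B :=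
      B15Prop1FromModel.critical_unique_of_chart (H i Vk) (Hst i Vk) (hadj i Vk) (Δ₁ i Vk) (dV i Vk) (J i Vk)
        (A := fun X => (I i).f (φ i Vk X)) (hA i Vk) hc (hpos i Vk) hh₁ hhst (hℓ i) (hH i Vk) (hHst i Vk) (hdV i Vk) (hρ i) hsmall' hBg hBr hBcrit hB'g
        hB'n h112'
    calc O' = orbitOf S V := (OrbitSp.orbitOf_eq_of_mem hV).symm
      _ = orbitOf S (φ i Vk B') := orbitOf_eq_orbitOf_iff.2 ⟨u, hu, hVu⟩
      _ = orbitOf S (φ i Vk B) := by rw [hEq]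
  · -- an element of the orbit is a minimum of the function over the variables ∩ the domain
    refine ⟨φ i Vk B, mem_orbitOf_self _ _, hsub (mem_orbit_self _ _), fun W hW => ?_⟩
    obtain ⟨B', hB'g, hB'n, u, hu, hWu⟩ := hc2 i ε Vk W hε hεD hreg hW
    rw [hWu, hc3'' i u _ hu]
    exact B15Prop1Minimum.le_of_critical (H i Vk) (Hst i Vk) (hadj i Vk) (Δ₁ i Vk) (dV i Vk) (J i Vk)
      (A := fun X => (I i).f (φ i Vk X)) (hA i Vk) hc (hpos i Vk) hh₁ hhst (hℓ i) (hH i Vk) (hHst i Vk) (hdV i Vk) (hρ i) hsmall' hBg hBr hBcrit hB'g hB'n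
  · -- (1.78) for the orbit
    have hB5 : 0 < (2 * a * hst * cJ / γ + b + 1) * (I i).M ^ 5 * ε := by positivity
    refine orbitDev_orbit_lt hB5 fun p hp => ?_
    calc dist1 (plaqHol (φ i Vk B) p) ≤ a * ‖B‖ + b * (I i).M ^ 2 * ε := hc4 i ε Vk B hε hreg hBg hBr p hp
      _ ≤ a * (2 * (I i).M ^ 5 * hst * cJ / γ * ε) + b * (I i).M ^ 2 * ε := by
          have := mul_le_mul_of_nonneg_left hBK ha
          linarith
      _ < (2 * a * hst * cJ / γ + b + 1) * (I i).M ^ 5 * ε := dev_arith hb (hM i) hε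

end Literature.MathematicalPhysics.QuantumFieldTheory.Balaban1983to89.B15Prop1CarrierOnFromModel

end
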